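import Literature.AlgebraicGeometry.HodgeTheory.RationallyChainConnectedChowRankOneHodge
import HarnessLib

/-!
# ALL of Grothendieck's amended general Hodge conjecture for a PRODUCT `Y × Z` of varieties with small Chow groups: `CH₀, …, CH_{k₀}(Y)` and `CH₀, …, CH_{k₁}(Z)` of rank `≤ 1`, `dim Y ≤ 2k₀ + 3`, `dim Z ≤ 2k₁ + 3`,
# `dim Y + dim Z ≤ 2(k₀ + k₁) + 6` ⟹ `GHC(Y × Z, i, r)` for every `(i, r)` — the general theorem behind g33-#11's eight tables; curve factors; rationally chain connected / Fano factors
# (Grothendieck 1969; Voisin I Thm. 11.38, Thm. 6.25; Voisin II Thm. 10.17, 10.29, 10.31, Prop. 9.20; Laterveer 1998; Vial 2013 Thm. 7.1; Bloch–Srinivas 1983; Kollár 1996; KMM 1992)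

Family `hodge`, lane `lit-hodgefound` (Track 2 foundations library; Layers A1/A4), layer `Literature/AlgebraicGeometry/HodgeTheory`.  THEOREMS ONLY (no definition, no named fact, no instance;
D-0026 net debt `0`).  Sequel of the seat's g33-#7 (`hodgeConjectureFor_tensor_of_chowRankLEOneUpTo`), g33-#9 (`supportedClasses_eq_top_of_chowRankLEOneUpTo_of_le`), g33-#10 (vanishing odd groups), g33-#11
(`generalHodgePropertyFor_tensor_of_forall_pieces`, `supportedClasses_eq_top_of_chowRankLEOneUpTo_of_add_eq_dim`, the tables) and g33-#13 (`IsRationallyChainConnected.chowRankLEOneUpTo_zero`).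

THE ARGUMENT.  The full coniveau PROFILE of an `m`-fold `X` with `CH₀, …, CH_{k₀}` of rank `≤ 1`, as a single function of the degree `i ≤ 2m`: `∞` (here the harmless bound `S`) on the odd degrees
`i ≤ 2k₀ + 1` and `i ≥ m` with `2m ≤ i + 2k₀ + 1` (those groups vanish, g33-#10); `min(k₀ + 1, ⌈i/2⌉)` for `i ≤ m` (generalised decomposition of the diagonal); `min(k₀ + 1, ⌈(2m − i)/2⌉) + (i − m)` for `i > m`
(hard Lefschetz transport, g33-#11) — `supportedClasses_profile_of_chowRankLEOneUpTo`.  For `Y × Z` in the stated range, every OFF-diagonal cell `(k, r)`, `2r < k ≤ dim Y + dim Z`, of the lower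
window has `r ≤ ρ_Y(i) + ρ_Z(j)` for all `i + j = k` (an elementary inequality, decided by `omega` after case splitting; checked numerically on `> 5·10⁵` cells before typing), hence `Nʳ Hᵏ(Y × Z) = Hᵏ(Y × Z)` by
g33-#11's product lemma; every DIAGONAL cell `(2c, c)` is `HC(Y × Z)` in degree `2c`, which holds by g33-#7 (`dim Y + dim Z ≤ 2(k₀ + k₁) + 7`).  Hard Lefschetz reduces `GHC` to the lower window.

WHAT IS PROVED (`0` sorrys; every statement a theorem).
* §1 `supportedClasses_profile_of_chowRankLEOneUpTo` (the profile, any bound `S` on the vanishing groups).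
* §2 **`forall_generalHodgePropertyFor_tensor_of_chowRankLEOneUpTo_of_add_le`** — ALL of `GHC(Y × Z)` for `ChowRankLEOneUpTo Y k₀`, `ChowRankLEOneUpTo Z k₁`, `dim Y ≤ 2k₀ + 3`, `dim Z ≤ 2k₁ + 3`,
  `dim Y + dim Z ≤ 2(k₀ + k₁) + 6` (contains g33-#11's `T × T'`, `T × X₅`, `X₅ × X₅'` and, e.g., `X₅ × X₇'` with `CH₀, …, CH₂(X₇')`, `F × F'` for fourfolds with `CH₀, CH₁`, …);
  **`forall_generalHodgePropertyFor_curve_tensor_of_chowRankLEOneUpTo`** (+ mirror) — ALL of `GHC(C × Z)` for ANY curve and `ChowRankLEOneUpTo Z k₁`, `dim Z ≤ 2k₁ + 3`.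
* §3 Rationally chain connected / Fano factors (`k = 0`, dimension `≤ 3`): ALL of `GHC(Y × Z)` for two rationally chain connected varieties with `dim Y, dim Z ≤ 3`; `C × Z` for `Z` rationally chain connected of
  dimension `≤ 3`; Fano forms granted KMM92; a rationally chain connected threefold times a fivefold with `CH₀, CH₁` small (either order).

THE PRINTS.  A. Grothendieck (1969) [GrothendieckTopology1969] §1, pp. 300–301; C. Voisin (2002) [VoisinHodgeI2002] §11.3.3 Thm. 11.38, §6.2.3 Thm. 6.25; C. Voisin (2003) [VoisinHodgeII2003] §9.2.4 Prop. 9.20, §10.2.2 Thm. 10.17,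
§10.3.1 Thm. 10.29, Thm. 10.31; R. Laterveer (1998) [Laterveer1998]; Ch. Vial (2013) [Vial2013] Thm. 7.1; S. Bloch, V. Srinivas (1983) [BlochSrinivas1983] Thm. 1; C. Voisin (2025) [Voisin2025] §4.3, §5.2 Cor. 5.7;
J. Kollár (1996) [Kollar1995] Def. 4.10; J. Kollár, Y. Miyaoka, S. Mori (1992) [KollarMiyaokaMori1992] Thm. 3.3; J. Murre (1994) [MurreTorino1994] §5.8.

THE OBJECTS (all the tree's).  `GeneralHodgePropertyFor`, `HodgeConjectureFor`, `supportedClasses`, `complexBetti`, `Motives.ChowRankLEOneUpTo`, `IsRationallyChainConnected`, `IsFano`,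
`KollarMiyaokaMori1992_fano_rationallyChainConnected` (hypothesis only); the tree's `forall_generalHodgePropertyFor_iff_lower_window`, `generalHodgePropertyFor_two_mul_self_of_hodgeConjectureFor`, and the seat's
`generalHodgePropertyFor_tensor_of_forall_pieces`, `supportedClasses_eq_top_of_chowRankLEOneUpTo_of_le`, `supportedClasses_eq_top_of_chowRankLEOneUpTo_of_add_eq_dim`, `supportedClasses_eq_top_of_subsingleton`,
`subsingleton_complexBetti_of_chowRankLEOneUpTo`, `subsingleton_complexBetti_of_chowRankLEOneUpTo_of_hardLefschetz`, `hodgeConjectureFor_tensor_of_chowRankLEOneUpTo`, `hodgeConjectureFor_tensor_of_dim_le_three_of_chowRankLEOneUpTo`,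
`IsRationallyChainConnected.chowRankLEOneUpTo_zero`.

DEVIATIONS / SCOPE.  Complex orientations (through the tree's supported-classes lemmas).  The numerical range is a sufficient condition for the METHOD (outside it some off-diagonal cell is not forced
by the profiles); e.g. `dim Y = 2k₀ + 4` is excluded although `HC(Y × Z)` may still hold.  No claim about a factor without a Chow hypothesis other than a curve.

## References
* [GrothendieckTopology1969] A. Grothendieck, Topology 8 (1969) — §1, pp. 300–301.
* [VoisinHodgeI2002] C. Voisin, *Hodge Theory and Complex Algebraic Geometry I* — §11.3.3 Thm. 11.38; §6.2.3 Thm. 6.25.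
* [VoisinHodgeII2003] C. Voisin, *Hodge Theory and Complex Algebraic Geometry II* — §9.2.4 Prop. 9.20; §10.2.2 Thm. 10.17; §10.3.1 Thm. 10.29, Thm. 10.31.
* [Laterveer1998] R. Laterveer, J. Math. Kyoto Univ. 38 (1998) — main theorem.
* [Vial2013] Ch. Vial, Doc. Math. 18 (2013) — Thm. 7.1.
* [BlochSrinivas1983] S. Bloch, V. Srinivas, Amer. J. Math. 105 (1983) — Thm. 1.
* [Voisin2025] C. Voisin (2025) — §4.3; §5.2 Cor. 5.7.
* [Kollar1995] J. Kollár, *Rational Curves on Algebraic Varieties* — Def. 4.10.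
* [KollarMiyaokaMori1992] J. Kollár, Y. Miyaoka, S. Mori, J. Differential Geom. 36 (1992) — Thm. 3.3.
* [MurreTorino1994] J. Murre, LNM 1594 — §5.8.

## Provenance
Lane `lit-hodgefound` (summit `HodgeConjecture`, Track 2 foundations), seat `lit-hodgefound-p29` (literature-prover, generation 33, row g33-#14).
-/

noncomputable section

open CategoryTheory AlgebraicGeometry MonoidalCategory Module Finset
open Literature.AlgebraicTopology.SingularHomology
open Literature.Geometry.Kaehler

namespace Literature.AlgebraicGeometry.HodgeTheory

open Literature.AlgebraicGeometry.Motives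

variable {n m : ℕ} {X Y Z C T : SchemeOver ℂ}

/-! ### §1 The coniveau profile of a variety with small Chow groups -/

/-- **The coniveau profile of an `m`-fold `X` with `CH₀, …, CH_{k₀}` of rank `≤ 1`**, in every degree `i ≤ 2m`: `Nᵖ Hⁱ(X) = Hⁱ(X)` for `p = ρ(i)` where `ρ(i) = S` (an arbitrary bound) on the VANISHING odd groups
(`i` odd and `i ≤ 2k₀ + 1`, or `i` odd, `i ≥ m`, `2m ≤ i + 2k₀ + 1`), `ρ(i) = min(k₀ + 1, ⌈i/2⌉)` for `i ≤ m` (generalised decomposition of the diagonal) and `ρ(i) = min(k₀ + 1, ⌈(2m − i)/2⌉) + (i − m)` for `i > m`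
(hard Lefschetz transport). [cite: VoisinHodgeII2003, Thm. 10.29, proof of Thm. 10.31 and §9.2.4 Prop. 9.20] [cite: Laterveer1998, main theorem (as quoted in Vial2013 Thm. 7.1)] [cite: VoisinHodgeI2002, §6.2.3 Thm. 6.25]
[cite: GrothendieckTopology1969, §1] -/
theorem supportedClasses_profile_of_chowRankLEOneUpTo (hX : IsSmoothProjective m X) {k₀ : ℕ} (hCH : ChowRankLEOneUpTo X k₀) (S i : ℕ) (hi : i ≤ 2 * m) :
    supportedClasses X i ((fun i : ℕ ↦ if i % 2 = 1 ∧ (i ≤ 2 * k₀ + 1 ∨ (m ≤ i ∧ 2 * m ≤ i + 2 * k₀ + 1)) then S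
      else if i ≤ m then min (k₀ + 1) ((i + 1) / 2) else min (k₀ + 1) ((2 * m - i + 1) / 2) + (i - m)) i) = ⊤ := by
  dsimp only
  split_ifs with h1 h2
  · rcases h1 with ⟨hodd, hsmall | ⟨hmi, hlarge⟩⟩
    · obtain ⟨p, rfl⟩ : ∃ p, i = 2 * p + 1 := ⟨i / 2, by omega⟩
      haveI : Subsingleton (complexBetti X (2 * p + 1)) := subsingleton_complexBetti_of_chowRankLEOneUpTo hX hCH (p := p) (by omega)
      exact supportedClasses_eq_top_of_subsingleton X _ S
    · haveI : Subsingleton (complexBetti X i) := subsingleton_complexBetti_of_chowRankLEOneUpTo_of_hardLefschetz hX hCH ⟨i / 2, by omega⟩ hmi (by omega)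
      exact supportedClasses_eq_top_of_subsingleton X i S
  · have hle : min (k₀ + 1) ((i + 1) / 2) ≤ (i + 1) / 2 := min_le_right _ _
    exact supportedClasses_eq_top_of_chowRankLEOneUpTo_of_le hX hCH (min_le_left _ _) (by omega)
  · obtain ⟨j, rfl⟩ : ∃ j, i = m + j := ⟨i - m, by omega⟩
    have hle₁ : min (k₀ + 1) ((2 * m - (m + j) + 1) / 2) ≤ k₀ + 1 := min_le_left _ _
    have hle₂ : min (k₀ + 1) ((2 * m - (m + j) + 1) / 2) ≤ (2 * m - (m + j) + 1) / 2 := min_le_right _ _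
    have h := supportedClasses_eq_top_of_chowRankLEOneUpTo_of_add_eq_dim hX hCH (k := m - j) (j := j) (r := min (k₀ + 1) ((2 * m - (m + j) + 1) / 2) + (m + j - m))
      (by omega) (by omega) (by omega)
    rwa [show m - j + 2 * j = m + j by omega] at h

/-! ### §2 All of `GHC(Y × Z)` -/

/-- **ALL of Grothendieck's amended general Hodge conjecture for `Y × Z` when `CH₀, …, CH_{k₀}(Y)` and `CH₀, …, CH_{k₁}(Z)` have rank `≤ 1`, `dim Y ≤ 2k₀ + 3`, `dim Z ≤ 2k₁ + 3` and
`dim Y + dim Z ≤ 2(k₀ + k₁) + 6`**: `GHC(Y × Z, i, r)` for every `(i, r)` — unconditionally.  Off-diagonal cells by the profiles of the factors (§1 with g33-#11's product lemma), diagonal cells by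
`HC(Y × Z)` (g33-#7), cells beyond `dim` by hard Lefschetz. [cite: GrothendieckTopology1969, §1, pp. 300–301] [cite: VoisinHodgeI2002, §11.3.3 Thm. 11.38 and §6.2.3 Thm. 6.25] [cite: VoisinHodgeII2003, §9.2.4 Prop. 9.20, Thm. 10.29 and proof of Thm. 10.31]
[cite: Laterveer1998, main theorem (as quoted in Vial2013 Thm. 7.1)] [cite: Vial2013, Thm 7.1 (first item)] [cite: Voisin2025, §4.3] -/
theorem forall_generalHodgePropertyFor_tensor_of_chowRankLEOneUpTo_of_add_le (hY : IsSmoothProjective m Y) (hZ : IsSmoothProjective n Z) {k₀ k₁ : ℕ} (hCHY : ChowRankLEOneUpTo Y k₀)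
    (hCHZ : ChowRankLEOneUpTo Z k₁) (hm : m ≤ 2 * k₀ + 3) (hn : n ≤ 2 * k₁ + 3) (hmn : m + n ≤ 2 * (k₀ + k₁) + 6) (i r : ℕ) : GeneralHodgePropertyFor (m + n) (Y ⊗ Z) i r := by
  refine (forall_generalHodgePropertyFor_iff_lower_window (hY.tensor_holds hZ)).2 (fun k r hr h2 hk _ ↦ ?_) i r
  rcases (show 2 * r = k ∨ 2 * r < k by omega) with hdiag | hoff
  · subst hdiag
    exact generalHodgePropertyFor_two_mul_self_of_hodgeConjectureFor (hY.tensor_holds hZ) (hodgeConjectureFor_tensor_of_chowRankLEOneUpTo hY hZ hCHY hCHZ (by omega) (by omega) (by omega)) r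
  · refine generalHodgePropertyFor_tensor_of_forall_pieces hY hZ _ _ (supportedClasses_profile_of_chowRankLEOneUpTo hY hCHY (m + n + 1))
      (supportedClasses_profile_of_chowRankLEOneUpTo hZ hCHZ (m + n + 1)) fun a b hab ha hb ↦ ?_
    simp only [Nat.min_def]
    split_ifs <;> omega

/-- **ALL of `GHC(C × Z)` for ANY smooth projective curve `C` and `Z` with `CH₀, …, CH_{k₁}` of rank `≤ 1`, `dim Z ≤ 2k₁ + 3`** (curve profile `(0, 0, 1)`; diagonal cells by `HC(C × Z)`, g33-#7).
[cite: GrothendieckTopology1969, §1, pp. 300–301] [cite: VoisinHodgeI2002, §11.3.3 Thm. 11.38] [cite: VoisinHodgeII2003, §9.2.4 Prop. 9.20, Thm. 10.29 and proof of Thm. 10.31] [cite: Voisin2025, §4.3] -/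
theorem forall_generalHodgePropertyFor_curve_tensor_of_chowRankLEOneUpTo (hC : IsSmoothProjective 1 C) (hZ : IsSmoothProjective n Z) {k₁ : ℕ} (hCHZ : ChowRankLEOneUpTo Z k₁) (hn : n ≤ 2 * k₁ + 3)
    (i r : ℕ) : GeneralHodgePropertyFor (1 + n) (C ⊗ Z) i r := by
  have tabC : ∀ i : ℕ, i ≤ 2 * 1 → supportedClasses C i ((fun i : ℕ ↦ if i = 2 then 1 else 0) i) = ⊤ := by
    intro i hi
    interval_cases i
    · exact supportedClasses_zero C 0
    · exact supportedClasses_zero C 1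
    · exact supportedClasses_eq_top_of_dim_add_le hC (i := 2) (r := 1) (by norm_num)
  refine (forall_generalHodgePropertyFor_iff_lower_window (hC.tensor_holds hZ)).2 (fun k r hr h2 hk _ ↦ ?_) i r
  rcases (show 2 * r = k ∨ 2 * r < k by omega) with hdiag | hoff
  · subst hdiag
    exact generalHodgePropertyFor_two_mul_self_of_hodgeConjectureFor (hC.tensor_holds hZ) (hodgeConjectureFor_tensor_of_dim_le_three_of_chowRankLEOneUpTo hC hZ hCHZ (by norm_num) (by omega)) r
  · refine generalHodgePropertyFor_tensor_of_forall_pieces hC hZ _ _ tabC (supportedClasses_profile_of_chowRankLEOneUpTo hZ hCHZ (1 + n + 1)) fun a b hab ha hb ↦ ?_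
    simp only [Nat.min_def]
    split_ifs <;> omega

/-- Mirror: **ALL of `GHC(Z × C)`**, `Z` with `CH₀, …, CH_{k₁}` of rank `≤ 1` and `dim Z ≤ 2k₁ + 3`, `C` any curve. [cite: GrothendieckTopology1969, §1, pp. 300–301] [cite: VoisinHodgeI2002, §11.3.3 Thm. 11.38]
[cite: VoisinHodgeII2003, Thm. 10.29 and proof of Thm. 10.31] -/
theorem forall_generalHodgePropertyFor_tensor_curve_of_chowRankLEOneUpTo (hZ : IsSmoothProjective n Z) (hC : IsSmoothProjective 1 C) {k₁ : ℕ} (hCHZ : ChowRankLEOneUpTo Z k₁) (hn : n ≤ 2 * k₁ + 3)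
    (i r : ℕ) : GeneralHodgePropertyFor (n + 1) (Z ⊗ C) i r := by
  have tabC : ∀ i : ℕ, i ≤ 2 * 1 → supportedClasses C i ((fun i : ℕ ↦ if i = 2 then 1 else 0) i) = ⊤ := by
    intro i hi
    interval_cases i
    · exact supportedClasses_zero C 0
    · exact supportedClasses_zero C 1
    · exact supportedClasses_eq_top_of_dim_add_le hC (i := 2) (r := 1) (by norm_num)
  refine (forall_generalHodgePropertyFor_iff_lower_window (hZ.tensor_holds hC)).2 (fun k r hr h2 hk _ ↦ ?_) i r
  rcases (show 2 * r = k ∨ 2 * r < k by omega) with hdiag | hoff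
  · subst hdiag
    exact generalHodgePropertyFor_two_mul_self_of_hodgeConjectureFor (hZ.tensor_holds hC) (hodgeConjectureFor_tensor_of_chowRankLEOneUpTo_of_dim_le_three hZ hC hCHZ (by norm_num) (by omega)) r
  · refine generalHodgePropertyFor_tensor_of_forall_pieces hZ hC _ _ (supportedClasses_profile_of_chowRankLEOneUpTo hZ hCHZ (n + 1 + 1)) tabC fun a b hab ha hb ↦ ?_
    simp only [Nat.min_def]
    split_ifs <;> omega

/-! ### §3 Rationally chain connected and Fano factors -/

/-- **ALL of `GHC(Y × Z)` for two rationally chain connected smooth projective varieties of dimension `≤ 3`** (`CH₀ = ℤ` on both; e.g. `T × T'`, `T × S`, `S × S'` with rationally connected factors).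
[cite: GrothendieckTopology1969, §1, pp. 300–301] [cite: Kollar1995, Def. 4.10] [cite: BlochSrinivas1983, Thm. 1] [cite: VoisinHodgeII2003, §10.2.2 Thm. 10.17 and §9.2.4 Prop. 9.20] -/
theorem forall_generalHodgePropertyFor_tensor_of_isRationallyChainConnected (hY : IsSmoothProjective m Y) (hZ : IsSmoothProjective n Z) (hRCY : IsRationallyChainConnected Y) (hRCZ : IsRationallyChainConnected Z)
    (hm : m ≤ 3) (hn : n ≤ 3) (i r : ℕ) : GeneralHodgePropertyFor (m + n) (Y ⊗ Z) i r :=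
  forall_generalHodgePropertyFor_tensor_of_chowRankLEOneUpTo_of_add_le hY hZ (hRCY.chowRankLEOneUpTo_zero hY) (hRCZ.chowRankLEOneUpTo_zero hZ) (by omega) (by omega) (by omega) i r

/-- **ALL of `GHC(F × F')` for two smooth complex FANO varieties of dimension `≤ 3`, granted KMM92.** [cite: KollarMiyaokaMori1992, Thm. 3.3] [cite: GrothendieckTopology1969, §1, pp. 300–301] [cite: BlochSrinivas1983, Thm. 1] -/
theorem forall_generalHodgePropertyFor_tensor_of_isFano (hKMM : KollarMiyaokaMori1992_fano_rationallyChainConnected) {F F' : SchemeOver ℂ} (hF : IsFano m F) (hF' : IsFano n F') (hm : m ≤ 3) (hn : n ≤ 3)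
    (i r : ℕ) : GeneralHodgePropertyFor (m + n) (F ⊗ F') i r :=
  forall_generalHodgePropertyFor_tensor_of_chowRankLEOneUpTo_of_add_le hF.isSmoothProjective hF'.isSmoothProjective (hKMM.chowRankLEOneUpTo_zero hF) (hKMM.chowRankLEOneUpTo_zero hF')
    (by omega) (by omega) (by omega) i r

/-- **ALL of `GHC(C × Z)` for any curve `C` and a rationally chain connected `Z` of dimension `≤ 3`.** [cite: GrothendieckTopology1969, §1, pp. 300–301] [cite: Kollar1995, Def. 4.10] [cite: BlochSrinivas1983, Thm. 1] -/
theorem forall_generalHodgePropertyFor_curve_tensor_of_isRationallyChainConnected (hC : IsSmoothProjective 1 C) (hZ : IsSmoothProjective n Z) (hRC : IsRationallyChainConnected Z) (hn : n ≤ 3)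
    (i r : ℕ) : GeneralHodgePropertyFor (1 + n) (C ⊗ Z) i r :=
  forall_generalHodgePropertyFor_curve_tensor_of_chowRankLEOneUpTo hC hZ (hRC.chowRankLEOneUpTo_zero hZ) (by omega) i r

/-- **ALL of `GHC(C × F)` for any curve `C` and a FANO variety `F` of dimension `≤ 3`, granted KMM92.** [cite: KollarMiyaokaMori1992, Thm. 3.3] [cite: GrothendieckTopology1969, §1, pp. 300–301] [cite: BlochSrinivas1983, Thm. 1] -/
theorem forall_generalHodgePropertyFor_curve_tensor_of_isFano (hKMM : KollarMiyaokaMori1992_fano_rationallyChainConnected) (hC : IsSmoothProjective 1 C) {F : SchemeOver ℂ} (hF : IsFano n F)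
    (hn : n ≤ 3) (i r : ℕ) : GeneralHodgePropertyFor (1 + n) (C ⊗ F) i r :=
  forall_generalHodgePropertyFor_curve_tensor_of_chowRankLEOneUpTo hC hF.isSmoothProjective (hKMM.chowRankLEOneUpTo_zero hF) (by omega) i r

/-- **ALL of `GHC(X × T)` for a fivefold `X` with `CH₀, CH₁` of rank `≤ 1` and a rationally chain connected threefold `T`** (`5 ≤ 5`, `3 ≤ 3`, `8 ≤ 2(1 + 0) + 6`). [cite: GrothendieckTopology1969, §1, pp. 300–301]
[cite: VoisinHodgeII2003, Thm. 10.17, Thm. 10.29 and proof of Thm. 10.31] [cite: Kollar1995, Def. 4.10] -/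
theorem forall_generalHodgePropertyFor_fivefold_tensor_threefold_of_chowRankLEOneUpTo_one_of_isRationallyChainConnected (hX : IsSmoothProjective 5 X) (hT : IsSmoothProjective 3 T)
    (hCH : ChowRankLEOneUpTo X 1) (hRC : IsRationallyChainConnected T) (i r : ℕ) : GeneralHodgePropertyFor (5 + 3) (X ⊗ T) i r :=
  forall_generalHodgePropertyFor_tensor_of_chowRankLEOneUpTo_of_add_le hX hT hCH (hRC.chowRankLEOneUpTo_zero hT) (by norm_num) (by norm_num) (by norm_num) i r

end Literature.AlgebraicGeometry.HodgeTheory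

end
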